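import Literature.Probability.Percolation.SlabCircuitGlueHighProb
import Literature.Probability.Percolation.SlabRSWLemma311
import Literature.Probability.Percolation.SlabRSWProp39Iter
import Literature.Probability.Percolation.SlabRSWHalfSide
import HarnessLib

/-!
# Newman–Tassion–Wu 2017, Theorem 3.8 (arXiv) — (H38): gluing the minimal circuits of two adjacent
# annuli, high-probability regime, in the REPAIRED window

Topic: `Literature/Probability/Percolation`.  Seventh file of the circuit gluing layer: its first
application.  NTW's Theorem 3.8 (arXiv; CPAM Theorem 3.10): with `Γ₁`, `Γ₂` the minimal open circuits of
`A_{m,n}(z)` and `A_{m,n}(z + 3n e_i)`, `P_p[Γ₁ ⟷^R Γ₂] ≥ h₁(f_p(3n,2m) · a(m,n)²)`.  The slab needs the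
window of the conclusion to contain the two annuli (p1 GEN 29, HOME H310-DESIGN §5: NTW's "the local
modification does not create any new circuit" argues with a path of `Ā_{m,n}`, not of
`R̄ = [0,3n]×[-m,m]‾`); we use the window `linkWindow z n i = [z₁-n, z₁+4n] × [z₂-n, z₂+n]` (direction
`e₀`; transposed for `e₁`), which contains `R(z)`, both annuli, and lies in the block window `z + B_{6n}`
of Lemma 3.11's renormalisation (`circuitBlockCore`), so nothing downstream changes.  The proof is two
applications of the circuit gluing lemma `circuitGlue_highProb` (`SlabCircuitGlueHighProb.lean`):
first glue the cluster of `col(Γ₁)` (the vertices of the window in the columns of `Γ₁`; a source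
determined off `B_n(z + 3n e_i)`) to `Γ₂`, then glue `Γ₂` (a source determined off `B_n(z)`) to `Γ₁`;
the starting event — both circuits and a long crossing of `R(z)` — forces a column contact by
`exists_sameColumn_of_isOSAP`.

* `linkWindow`, `linkEvent'`, `linkEvent'_subset_link`.
* `linkGlueA`, `linkGlueB` — the two circuit-gluing data; `evCol_linkGlueA_of_cross`,
  `evCol_linkGlueB_of_evGlued_A`, `linkEvent'_of_evGlued_B`.
* **`h38_window`** — (H38) in the repaired window: `∀ ε η ∃ δ ∀ p ∈ [ε,1-ε] ∀ 1 ≤ m ≤ n ∀ z i`,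
  `f_p(3n,2m) ≥ 1-δ`, `P[𝒜_{m,n}(z)] ≥ 1-δ`, `P[𝒜_{m,n}(z+3n e_i)] ≥ 1-δ ⟹ P[linkEvent'] ≥ 1-η`.

## Sources

* C. M. Newman, V. Tassion, W. Wu, *Critical percolation and the minimal spanning tree in slabs*,
  Comm. Pure Appl. Math. 70 (2017) = arXiv:1512.09107: Theorem 3.8 (arXiv) = Theorem 3.10 (CPAM) and its
  proof ((3.5), (3.6), FKG); §3.4, proof of Lemma 3.11 (the events X(e)) [NewmanTassionWu2017].
-/

noncomputable section

namespace Literature.Probability.Percolation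

open MeasureTheory LatticeModels SimpleGraph

namespace NTW17

variable {k : ℕ}

/-! ## The repaired window and link event -/

/-- **The repaired window** of the coarse edge from `z` in direction `i`: `[z₁-n, z₁+4n] × [z₂-n, z₂+n]`
(`i = 0`), `[z₁-n, z₁+n] × [z₂-n, z₂+4n]` (`i = 1`) — contains `R_i(z)` and both annuli.
[cite: NewmanTassionWu2017, §3.4 (proof of Lemma 3.11, the window of X(e)); Theorem 3.8] -/
def linkWindow (z : ℤ × ℤ) (n : ℕ) (i : Fin 2) : Set (ℤ × ℤ) :=
  if i = 0 then boxR (z.1 - n) (z.1 + 4 * n) (z.2 - n) (z.2 + n) else boxR (z.1 - n) (z.1 + n) (z.2 - n) (z.2 + 4 * n)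

/-- **The repaired edge event**: the minimal circuits of `Ā_{m,n}(z)` and `Ā_{m,n}(z + 3n eᵢ)` are joined by
an open path inside the repaired window. [cite: NewmanTassionWu2017, §3.4 (proof of Lemma 3.11, X(e) = 1); Theorem 3.8] -/
def linkEvent' (k : ℕ) (z : ℤ × ℤ) (m n : ℕ) (i : Fin 2) : Set (BondConfig (slab 3 k)) :=
  {ω | ∃ a ∈ minCircuit k ω z m n, ∃ b ∈ minCircuit k ω (z + coarseShift (3 * n) i) m n,
    ω ∈ openConnIn (slabLift k (linkWindow z n i)) a b}

/-- Membership in the window, in coordinates. [cite: NewmanTassionWu2017, §3.4 (proof of Lemma 3.11)] -/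
theorem mem_linkWindow_iff (z w : ℤ × ℤ) (n : ℕ) (i : Fin 2) :
    w ∈ linkWindow z n i ↔ (i = 0 ∧ z.1 - n ≤ w.1 ∧ w.1 ≤ z.1 + 4 * n ∧ z.2 - n ≤ w.2 ∧ w.2 ≤ z.2 + n) ∨
      (i = 1 ∧ z.1 - n ≤ w.1 ∧ w.1 ≤ z.1 + n ∧ z.2 - n ≤ w.2 ∧ w.2 ≤ z.2 + 4 * n) := by
  fin_cases i <;> simp [linkWindow, mem_boxR_iff]

/-- The repaired window lies in the block window `z + B_{6n}`. [cite: NewmanTassionWu2017, §3.4 (proof of Lemma 3.11)] -/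
theorem linkWindow_subset_sqBox (z : ℤ × ℤ) (n : ℕ) (i : Fin 2) : linkWindow z n i ⊆ sqBox z (2 * (3 * n)) := by
  intro w hw
  rw [mem_linkWindow_iff] at hw
  simp only [sqBox, Set.mem_setOf_eq, abs_le]
  push_cast
  omega

/-- **The repaired edge event implies the link event of the block structure** (same cores, smaller window).
[cite: NewmanTassionWu2017, §3.4 (proof of Lemma 3.11)] -/
theorem linkEvent'_subset_link (z : ℤ × ℤ) {m n : ℕ} (hn : 1 ≤ n) (i : Fin 2) :
    linkEvent' k z m n i ⊆ (circuitBlockCore k m n hn).link z i := by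
  rintro ω ⟨a, ha, b, hb, hab⟩
  exact ⟨a, ha, b, hb, openConnIn_mono (slabLift_mono k (linkWindow_subset_sqBox z n i)) a b hab⟩

/-- The window is finite. [cite: NewmanTassionWu2017, §3.4 (proof of Lemma 3.11)] -/
theorem linkWindow_finite (z : ℤ × ℤ) (n : ℕ) (i : Fin 2) : (linkWindow z n i).Finite := by
  unfold linkWindow; split_ifs <;> exact boxR_finite _ _ _ _

/-- Both annuli' boxes lie in the window. [cite: NewmanTassionWu2017, Theorem 3.8 (R ⊇ the two annuli, repaired)] -/
theorem sqBox_subset_linkWindow (z : ℤ × ℤ) (n : ℕ) (i : Fin 2) :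
    sqBox z n ⊆ linkWindow z n i ∧ sqBox (z + coarseShift (3 * n) i) n ⊆ linkWindow z n i := by
  constructor <;> intro w hw <;> rw [mem_linkWindow_iff] <;>
    fin_cases i <;> simp [sqBox, abs_le, coarseShift] at hw ⊢ <;> omega

/-- The two boxes `B_n(z)`, `B_n(z + 3n eᵢ)` are disjoint (`n ≥ 1`). [cite: NewmanTassionWu2017, Theorem 3.8 (the annuli A_{m,n}(0), A_{m,n}((3n,0)))] -/
theorem disjoint_sqBox_shift (z : ℤ × ℤ) {n : ℕ} (hn : 1 ≤ n) (i : Fin 2) :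
    Disjoint (sqBox z n) (sqBox (z + coarseShift (3 * n) i) n) := by
  refine Set.disjoint_left.2 fun w hw hw' => ?_
  fin_cases i <;> simp [sqBox, abs_le, coarseShift] at hw hw' <;> omega

/-- Pairs over `B_n(c)` are pairs over the window not touching a disjoint box. [cite: NewmanTassionWu2017, Theorem 3.8] -/
private theorem agree_sqBox_of_agree {c c' z : ℤ × ℤ} {n : ℕ} {i : Fin 2} (hcW : sqBox c n ⊆ linkWindow z n i)
    (hdisj : Disjoint (sqBox c n) (sqBox c' n)) {ω ω' : BondConfig (slab 3 k)}
    (h : ∀ e ∈ (slabLift k (linkWindow z n i)).sym2, e ∉ touch k (sqBox c' n) → (e ∈ ω ↔ e ∈ ω')) :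
    ω ∩ Set.sym2 (slabLift k (sqBox c n)) = ω' ∩ Set.sym2 (slabLift k (sqBox c n)) := by
  ext e
  simp only [Set.mem_inter_iff]
  constructor <;> rintro ⟨he, hm⟩ <;> refine ⟨?_, hm⟩
  all_goals
    have h1 : e ∈ (slabLift k (linkWindow z n i)).sym2 := CircGlue.sym2_slabLift_mono hcW hm
    have h2 : e ∉ touch k (sqBox c' n) := by
      rintro ⟨x, hx, hxD⟩
      induction e using Sym2.ind with
      | h a b =>
        rw [Set.mk_mem_sym2_iff] at hm
        rcases Sym2.mem_iff.1 hx with rfl | rfl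
        · exact Set.disjoint_left.1 hdisj (by have := hm.1; rwa [mem_slabLift_iff] at this) hxD
        · exact Set.disjoint_left.1 hdisj (by have := hm.2; rwa [mem_slabLift_iff] at this) hxD
  · exact (h e h1 h2).1 he
  · exact (h e h1 h2).2 he

/-! ## The two circuit-gluing data -/

/-- **Step A**: glue the cluster of the window's vertices in the columns of `Γ₁` (source) to `Γ₂` (the
minimal circuit of the second annulus). [cite: NewmanTassionWu2017, Theorem 3.8 (proof, (3.6): U(ω) = {z ∈ Γ̄₂ connected to Γ̄₁})] -/
def linkGlueA (k : ℕ) (z : ℤ × ℤ) (m n : ℕ) (hn : 1 ≤ n) (i : Fin 2) : CircGlue k where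
  c := z + coarseShift (3 * n) i
  m := m
  n := n
  W := linkWindow z n i
  Csupp := sqBox z n
  src := fun ω => {x | x ∈ slabLift k (linkWindow z n i) ∧ Near k (minCircuit k ω z m n) 0 (planar k x)}
  hWfin := linkWindow_finite z n i
  hAW := (annulus_subset_sqBox _ _ _).trans (sqBox_subset_linkWindow z n i).2
  hCW := (sqBox_subset_linkWindow z n i).1
  hCfar := disjoint_sqBox_shift z hn i
  hsrc := fun ω x hx => by
    obtain ⟨g, hg, hgx⟩ := near_zero_iff.1 hx.2
    rw [mem_slabLift_iff, ← hgx]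
    have := minCircuit_subset ω z m n g hg
    rwa [mem_slabLift_iff] at this
  hsrc_loc := fun ω ω' h => by
    have hΓ : minCircuit k ω z m n = minCircuit k ω' z m n :=
      minCircuit_local (agree_sqBox_of_agree (sqBox_subset_linkWindow z n i).1 (disjoint_sqBox_shift z hn i) h)
    ext x; simp only [Set.mem_setOf_eq, hΓ]

/-- **Step B**: glue `Γ₂` (source = its vertices) to `Γ₁`. [cite: NewmanTassionWu2017, Theorem 3.8 (proof, (3.5): U(ω) = {z ∈ Γ̄₁ connected to Γ₂})] -/
def linkGlueB (k : ℕ) (z : ℤ × ℤ) (m n : ℕ) (hn : 1 ≤ n) (i : Fin 2) : CircGlue k where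
  c := z
  m := m
  n := n
  W := linkWindow z n i
  Csupp := sqBox (z + coarseShift (3 * n) i) n
  src := fun ω => {x | x ∈ minCircuit k ω (z + coarseShift (3 * n) i) m n}
  hWfin := linkWindow_finite z n i
  hAW := (annulus_subset_sqBox _ _ _).trans (sqBox_subset_linkWindow z n i).1
  hCW := (sqBox_subset_linkWindow z n i).2
  hCfar := (disjoint_sqBox_shift z hn i).symm
  hsrc := fun ω x hx => minCircuit_subset ω _ m n x hx
  hsrc_loc := fun ω ω' h => by
    have hΓ : minCircuit k ω (z + coarseShift (3 * n) i) m n = minCircuit k ω' (z + coarseShift (3 * n) i) m n :=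
      minCircuit_local (agree_sqBox_of_agree (sqBox_subset_linkWindow z n i).2 (disjoint_sqBox_shift z hn i).symm h)
    ext x; simp only [Set.mem_setOf_eq, hΓ]

/-! ## The deterministic steps -/

/-- The reversal of an open self-avoiding path. [cite: NewmanTassionWu2017, §3.2 (paths)] -/
private theorem isOSAP_reverse' {ω : BondConfig (slab 3 k)} {S X Y : Set (slab 3 k)} {l : List (slab 3 k)}
    (h : IsOSAP k ω S X Y l) : IsOSAP k ω S Y X l.reverse :=
  ⟨List.nodup_reverse.2 h.nodup,
    by rw [List.isChain_reverse]; exact h.chain.imp fun a b hab => ⟨by rw [Sym2.eq_swap]; exact hab.1, hab.2.symm⟩,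
    fun x hx => h.subset x (List.mem_reverse.1 hx), by simpa using h.ne_nil,
    fun hne => by rw [List.head_reverse]; exact h.last_mem _,
    fun hne => by rw [List.getLast_reverse]; exact h.head_mem _⟩

/-- **The starting event forces a column contact for step A**: if both minimal circuits exist and the
window `R_i(z)` is crossed the long way (from inside `B_m(z)` to inside `B_m(z + 3n eᵢ)`), the crossing
passes through a column of `Γ₁` and a column of `Γ₂`, so a window vertex in a column of `Γ₁` is joined
inside the window to a vertex in a column of `Γ₂`.
[cite: NewmanTassionWu2017, Theorem 3.8 (proof: "{L(R) ⟷ R(R)} … implies", FKG step)] -/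
theorem evCol_linkGlueA_of_cross {z : ℤ × ℤ} {m n : ℕ} (hn : 1 ≤ n) (hmn : m ≤ n) (i : Fin 2)
    {ω : BondConfig (slab 3 k)} (hω : ω ⊆ (slabGraph 3 k).edgeSet)
    (h₁ : ω ∈ circuitAround k z m n) (h₂ : ω ∈ circuitAround k (z + coarseShift (3 * n) i) m n)
    (hcross : ω ∈ slabConn k (linkRect z m n i)
      (if i = 0 then {w | w.1 = z.1} else {w | w.2 = z.2})
      (if i = 0 then {w | w.1 = z.1 + 3 * n} else {w | w.2 = z.2 + 3 * n})) :
    ω ∈ (linkGlueA k z m n hn i).evCol := by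
  obtain ⟨⟨hc₁, hs₁⟩, -⟩ := minCircuit_spec h₁
  obtain ⟨⟨hc₂, hs₂⟩, -⟩ := minCircuit_spec h₂
  obtain ⟨L, hL⟩ := (mem_slabConn_iff_exists_isOSAP ω _ _ _).1 hcross
  have hRW : linkRect z m n i ⊆ linkWindow z n i := by
    intro w hw
    rw [mem_linkWindow_iff]
    fin_cases i <;> simp [linkRect, mem_boxR_iff] at hw ⊢ <;> omega
  have hhead := hL.head_mem hL.ne_nil
  have hlast := hL.last_mem hL.ne_nil
  have hheadR : planar k (L.head hL.ne_nil) ∈ linkRect z m n i := by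
    have := hL.subset _ (List.head_mem hL.ne_nil); rwa [mem_slabLift_iff] at this
  have hlastR : planar k (L.getLast hL.ne_nil) ∈ linkRect z m n i := by
    have := hL.subset _ (List.getLast_mem hL.ne_nil); rwa [mem_slabLift_iff] at this
  rw [mem_slabLift_iff] at hhead hlast
  -- the crossing starts inside `B_m(z)` and ends outside `B_n(z)`
  have hstart : planar k (L.head hL.ne_nil) ∈ sqBox z m := by
    fin_cases i <;> simp [linkRect, mem_boxR_iff, sqBox, abs_le] at hheadR hhead ⊢ <;> omega
  have hend : planar k (L.getLast hL.ne_nil) ∉ sqBox z n := by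
    fin_cases i <;> simp [linkRect, mem_boxR_iff, sqBox, abs_le] at hlastR hlast ⊢ <;> omega
  obtain ⟨w₁, hw₁L, v₁, hv₁, hw₁v₁⟩ := exists_sameColumn_of_isOSAP hω hc₁ hs₁ hL hstart hend
  -- and (reversed) starts inside `B_m(z')` and ends outside `B_n(z')`
  have hL' := isOSAP_reverse' hL
  have hstart' : planar k (L.reverse.head hL'.ne_nil) ∈ sqBox (z + coarseShift (3 * n) i) m := by
    rw [List.head_reverse]
    fin_cases i <;> simp [linkRect, mem_boxR_iff, sqBox, abs_le, coarseShift] at hlastR hlast ⊢ <;> omega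
  have hend' : planar k (L.reverse.getLast hL'.ne_nil) ∉ sqBox (z + coarseShift (3 * n) i) n := by
    rw [List.getLast_reverse]
    fin_cases i <;> simp [linkRect, mem_boxR_iff, sqBox, abs_le, coarseShift] at hheadR hhead ⊢ <;> omega
  obtain ⟨w₂, hw₂L, v₂, hv₂, hw₂v₂⟩ := exists_sameColumn_of_isOSAP hω hc₂ hs₂ hL' hstart' hend'
  rw [List.mem_reverse] at hw₂L
  -- `w₁ ⟷ w₂` along the crossing, inside the window
  have hconn : ω ∈ openConnIn (slabLift k (linkWindow z n i)) w₁ w₂ :=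
    openConnIn_mono (slabLift_mono k hRW) _ _
      (SlabCriticality.openConnIn_trans (openConnIn_reverse (hL.openConnIn_of_mem hw₁L)) (hL.openConnIn_of_mem hw₂L))
  refine ⟨w₁, ⟨slabLift_mono k hRW (hL.subset w₁ hw₁L), near_zero_iff.2 ⟨v₁, hv₁, hw₁v₁.symm⟩⟩, w₂, hconn,
    near_zero_iff.2 ⟨v₂, hv₂, hw₂v₂.symm⟩⟩

/-- **Step A's conclusion is step B's hypothesis.** [cite: NewmanTassionWu2017, Theorem 3.8 (proof, (3.5) after (3.6))] -/
theorem evCol_linkGlueB_of_evGlued_A {z : ℤ × ℤ} {m n : ℕ} (hn : 1 ≤ n) (i : Fin 2) {ω : BondConfig (slab 3 k)}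
    (h : ω ∈ (linkGlueA k z m n hn i).evGlued) : ω ∈ (linkGlueB k z m n hn i).evCol := by
  obtain ⟨c₀, ⟨-, hc₀⟩, g, hg, hj⟩ := h
  exact ⟨g, hg, c₀, openConnIn_reverse hj, hc₀⟩

/-- **Step B's conclusion is the repaired edge event.** [cite: NewmanTassionWu2017, Theorem 3.8 (the event Γ₁ ⟷^R Γ₂)] -/
theorem linkEvent'_of_evGlued_B {z : ℤ × ℤ} {m n : ℕ} (hn : 1 ≤ n) (i : Fin 2) {ω : BondConfig (slab 3 k)}
    (h : ω ∈ (linkGlueB k z m n hn i).evGlued) : ω ∈ linkEvent' k z m n i := by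
  obtain ⟨c₀, hc₀, g, hg, hj⟩ := h
  exact ⟨g, hg, c₀, hc₀, openConnIn_reverse hj⟩

/-! ## (H38) in the repaired window -/

/-- The long crossing of `R_i(z)` has probability `f_p(3n, 2m)`. [cite: NewmanTassionWu2017, §3.4 (proof of Lemma 3.11, (3.76)); §3.3 (translation invariance)] -/
theorem real_cross_linkRect (z : ℤ × ℤ) (m n : ℕ) (i : Fin 2) (p : unitInterval) :
    (bondPercolation (slabGraph 3 k) p).real (slabConn k (linkRect z m n i)
      (if i = 0 then {w | w.1 = z.1} else {w | w.2 = z.2})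
      (if i = 0 then {w | w.1 = z.1 + 3 * n} else {w | w.2 = z.2 + 3 * n})) = crossingProb k p (3 * n) (2 * m) := by
  rw [crossingProb_eq]
  push_cast
  fin_cases i
  · simp only [linkRect, Fin.zero_eta, Fin.isValue, ↓reduceIte]
    have h := real_lr_shift (k := k) ((z.1, z.2 - m) : ℤ × ℤ) 0 (3 * n) 0 (2 * m) p
    simp only [zero_add] at h
    rw [show (3 : ℤ) * n + z.1 = z.1 + 3 * n by ring, show (2 : ℤ) * m + (z.2 - m) = z.2 + m by ring] at h
    exact h
  · simp only [linkRect, Fin.mk_one, Fin.isValue, one_ne_zero, ↓reduceIte]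
    rw [real_bt_eq_lr]
    have h := real_lr_shift (k := k) ((z.2, z.1 - m) : ℤ × ℤ) 0 (3 * n) 0 (2 * m) p
    simp only [zero_add] at h
    rw [show (3 : ℤ) * n + z.2 = z.2 + 3 * n by ring, show (2 : ℤ) * m + (z.1 - m) = z.1 + m by ring] at h
    exact h

/-- **(H38) — NTW's Theorem 3.8 (arXiv), `ε-δ` form, repaired window.**  For every `k`, `ε > 0`, `η > 0`
there is `δ > 0` such that for all `p ∈ [ε, 1-ε]`, `1 ≤ m ≤ n`, `z`, `i`: if `f_p(3n, 2m) ≥ 1-δ` and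
both `P_p[𝒜_{m,n}(z)] ≥ 1-δ`, `P_p[𝒜_{m,n}(z + 3n eᵢ)] ≥ 1-δ`, then the minimal circuits are joined inside
`linkWindow z n i` with probability `≥ 1-η`.  Proof: the three events force `col(Γ₁) ⟷ col(Γ₂)` inside
the window; two applications of the circuit gluing lemma `circuitGlue_highProb` (steps A and B).
[cite: NewmanTassionWu2017, Theorem 3.8 (arXiv) = Theorem 3.10 (CPAM): P[Γ₁ ⟷ Γ₂] ≥ h₁(f(3n,2m) a(m,n)²)] -/
theorem h38_window (k : ℕ) {ε : ℝ} (hε : 0 < ε) {η : ℝ} (hη : 0 < η) :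
    ∃ δ : ℝ, 0 < δ ∧ ∀ p : unitInterval, ε ≤ (p : ℝ) → (p : ℝ) ≤ 1 - ε →
      ∀ m n : ℕ, 1 ≤ m → m ≤ n → ∀ (z : ℤ × ℤ) (i : Fin 2),
      1 - δ ≤ crossingProb k p (3 * n) (2 * m) →
      1 - δ ≤ (bondPercolation (slabGraph 3 k) p).real (circuitAround k z m n) →
      1 - δ ≤ (bondPercolation (slabGraph 3 k) p).real (circuitAround k (z + coarseShift (3 * n) i) m n) →
      1 - η ≤ (bondPercolation (slabGraph 3 k) p).real (linkEvent' k z m n i) := by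
  -- step B's δ, then step A's δ for the target `δ_B`
  obtain ⟨δB, hδB, HB⟩ := circuitGlue_highProb k hε hη
  obtain ⟨δA, hδA, HA⟩ := circuitGlue_highProb k hε hδB
  refine ⟨δA / 3, by positivity, fun p hpε hp1 m n hm hmn z i hf h1 h2 => ?_⟩
  have hn : 1 ≤ n := hm.trans hmn
  set P := bondPercolation (slabGraph 3 k) p with hP
  set DA := linkGlueA k z m n hn i with hDA
  set DB := linkGlueB k z m n hn i with hDB
  -- the starting event has probability ≥ 1 - δA
  set X : Set (BondConfig (slab 3 k)) := slabConn k (linkRect z m n i)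
      (if i = 0 then {w | w.1 = z.1} else {w | w.2 = z.2})
      (if i = 0 then {w | w.1 = z.1 + 3 * n} else {w | w.2 = z.2 + 3 * n}) with hX
  have hXm : MeasurableSet X := by
    rw [hX]; unfold linkRect; split_ifs <;> exact measurableSet_slabConn_boxR _ _ _ _ _ _
  have hA1m : MeasurableSet (circuitAround k z m n : Set (BondConfig (slab 3 k))) := measurableSet_circuitAround _ _ _
  have hA2m : MeasurableSet (circuitAround k (z + coarseShift (3 * n) i) m n : Set (BondConfig (slab 3 k))) :=
    measurableSet_circuitAround _ _ _
  have hPX : 1 - δA / 3 ≤ P.real X := by rw [hX, real_cross_linkRect]; exact hf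
  have hcol : 1 - δA ≤ P.real DA.evCol := by
    set S := circuitAround k z m n ∩ circuitAround k (z + coarseShift (3 * n) i) m n ∩ X with hS
    have hae : ∀ᵐ ω ∂P, ω ∈ S → ω ∈ DA.evCol := by
      filter_upwards [ae_subset_edgeSet (slabGraph 3 k) p] with ω hω h
      exact evCol_linkGlueA_of_cross hn hmn i hω h.1.1 h.1.2 h.2
    have h3 : P.real S ≤ P.real DA.evCol := by
      simp only [measureReal_def]
      exact ENNReal.toReal_mono (measure_ne_top _ _) (measure_mono_ae hae)
    have hm3 : MeasurableSet S := (hA1m.inter hA2m).inter hXm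
    have hc1 : P.real (circuitAround k z m n)ᶜ ≤ δA / 3 := by rw [probReal_compl_eq_one_sub hA1m]; linarith
    have hc2 : P.real (circuitAround k (z + coarseShift (3 * n) i) m n)ᶜ ≤ δA / 3 := by
      rw [probReal_compl_eq_one_sub hA2m]; linarith
    have hc3 : P.real Xᶜ ≤ δA / 3 := by rw [probReal_compl_eq_one_sub hXm]; linarith
    have hcS : P.real Sᶜ ≤ δA := by
      rw [hS, Set.compl_inter, Set.compl_inter]
      calc P.real ((circuitAround k z m n)ᶜ ∪ (circuitAround k (z + coarseShift (3 * n) i) m n)ᶜ ∪ Xᶜ)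
          ≤ P.real ((circuitAround k z m n)ᶜ ∪ (circuitAround k (z + coarseShift (3 * n) i) m n)ᶜ) + P.real Xᶜ :=
            measureReal_union_le _ _
        _ ≤ (P.real (circuitAround k z m n)ᶜ + P.real (circuitAround k (z + coarseShift (3 * n) i) m n)ᶜ) + P.real Xᶜ := by
            gcongr; exact measureReal_union_le _ _
        _ ≤ δA / 3 + δA / 3 + δA / 3 := by linarith
        _ = δA := by ring
    have hSc : P.real Sᶜ = 1 - P.real S := probReal_compl_eq_one_sub hm3
    linarith
  -- step A
  have hgluedA : 1 - δB ≤ P.real DA.evGlued := HA DA p hpε hp1 hcol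
  -- step B
  have hcolB : 1 - δB ≤ P.real DB.evCol :=
    hgluedA.trans (measureReal_mono fun ω hω => evCol_linkGlueB_of_evGlued_A hn i hω)
  have hgluedB : 1 - η ≤ P.real DB.evGlued := HB DB p hpε hp1 hcolB
  exact hgluedB.trans (measureReal_mono fun ω hω => linkEvent'_of_evGlued_B hn i hω)

end NTW17

end Literature.Probability.Percolation

end
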